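import Summits.QuantumFields.YangMills.Theorems.UnitScaleTiltProp7DbarJointAnalytic
import Summits.QuantumFields.YangMills.Theorems.UnitScaleTiltProp7SymFrameCovariance
import Summits.QuantumFields.YangMills.Theorems.UnitScaleTiltProp7SymFrameCovLocality
import Summits.QuantumFields.YangMills.Theorems.UnitScaleTiltProp7QSymCovDefect
import HarnessLib

/-!
# Route `UnitScaleTilt`, crux K1 «MinimiserStabilityRegPr» (stmt-QuantumFields-19200), route-R E′ (A′) «HCOW-VIA-Σ» (★★OWNER RULING g28-№13), package P-A2 «JOINT-Σ»,
# row F2″-COV (★p1 g17 NAMER WORD 16 (c)), FILE B — **THE COVARIANT LINEARISATION ROW OF THE DOUBLE-BAR ONE STEP: AT A BACKGROUND WHICH A GAUGE `û` MAKES `s_B`-FLAT ON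
# THE TWO BLOCKS OF THE COARSE BOND, THE LINEARISED ONE-STEP CHART `∂_A|₀ log[U̿(V₀; e^{A}V₀)(c)·Ū(V₀)(c)⁻¹]` IS, UP TO `(16M₁′∕ρ²)·2s_B·‖Y‖`, THE `û`-TRANSPORTED FLAT
# LINEARISED DOUBLE BAR** (the shape of ★w4-20520 g2's ✓`Prop7SymAvgRelativeBound.differentiableAt_logRel_zero` VERBATIM, with `emlIterU k ↦` one covariant double-bar step and
# `transfUp û k e.src ↦ û (emb c.src)`).

Cell `ym3-torus`, D-0154 (3c) twin-width seat `ym-routeR-w3` (gen 7).  YM₃ on T³ is a ladder rung (R3), NOT the Clay problem; nothing here is a claim about the stub, the crux,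
d = 4 or the mass gap.  `--supports stmt-QuantumFields-19200 --as helper`; count-neutral; def-free.

THE ARGUMENT (all by name).  Background `V₀ : GaugeField P j 𝔸ˣ`, gauge `û : T^{(j)} → 𝔸ˣ` with `‖û‖, ‖û⁻¹‖ ≤ 1`, coarse bond `c` of level `j + 1`; hypothesis: on every level-`j` bond `b`
with both ends in `B(c₋) ∪ B(c₊)`, `‖V₀^{û}(b) − 1‖ ≤ s_B` (`4s_B < ρ`, one-step budget `10⁷ℓ²ρ ≤ 1` of FILE A).  (1) COVARIANCE: the relative double bar conjugates at the centre,
`U̿(V₀; W)(c)·Ū(V₀)(c)⁻¹ = T⁻¹·[U̿(V₀^{û}; W^{û})(c)·Ū(V₀^{û})(c)⁻¹]·T`, `T := û(emb c₋)` (✓`Prop7SymFrameCovariance.dbarCovU_gaugeActT` + ✓`Prop8Chart.emlAvgU_gaugeActT`), and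
`(e^{A}V₀)^{û}(b) = e^{Ad_û A(b)}·V₀^{û}(b)`; (2) LOCALITY: on the two blocks `V₀^{û}(b) = e^{B₀(b)}` with `B₀(b) := log V₀^{û}(b)` there and `0` elsewhere, `‖B₀‖ ≤ 2s_B < ρ∕2`, and the
double bar at `c` reads only those bonds — in the field (✓`Prop7SymFrameCovLocality.dbarCovU_congr₂`) AND in the background (`dbarCovU_congr_bg`, this file: the background enters
only through the centre-stair legs of the frames, which stay in their blocks); (3) `log(T⁻¹XT) = T⁻¹(log X)T`; so the chart at `V₀` is `conj_T ∘ slice_{B₀} ∘ Ad_û`, chain rule;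
(4) FILE A ★★`Prop7DbarJointAnalytic.norm_fderiv_dbarSlice_sub_fderiv_flat_le` bounds `slice_{B₀}′(0) − flat′(0)` by `(16M₁′∕ρ²)‖B₀‖`, and `conj_T`, `Ad_û` do not increase norms.

WHAT THIS FILE PROVES (sorry-free, no definition).
* §1 letters at level `j`: `norm_adField_le` (the bondwise conjugation `Ad_û` does not increase the sup norm; ✓`NE9RelativeChartPlaquette.norm_conj_le`), `gaugeActT_perturbed` (✓`expUnit_conj`);
  background locality `tstairU_congr_bg`, `vframeCovU_congr_bg`, `dbarCovU_congr_bg`; ★`dbarRel_eq_conj` (covariance of the relative double bar, (1)).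
* §2 ★★★ **`differentiableAt_dbarLogRel_zero`** — under the hypotheses above the chart `A ↦ log[U̿(V₀; e^{A}V₀)(c)·Ū(V₀)(c)⁻¹]` is differentiable at `0`, and for every `Y`
  `‖∂_A|₀ chart·Y − T⁻¹·(∂_A|₀ log U̿(e^{A})(c)·(Ad_û Y))·T‖ ≤ (16·(12Lρ)∕ρ²)·(2s_B)·‖Y‖`.
HONEST SCOPE.  Bookkeeping; the estimate is FILE A's Schwarz bound.  The column sum (flat part `= L•bondAvg` by ✓`Prop8ChartDoubleBarDeriv`, isometry of `Ad`∕`conj`, read-set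
truncation, ✓`Prop7TubeAverageL1Damping.sum_norm_bondAvg_le`) is FILE C; the T³∕`RegPr` reading (block-centre axial gauges per level) is FILE D.  Nothing of P-A2, hcoW, E′, EX or the
crux is claimed.

References: T. Bałaban, CMP **98** (1985) 17–51 [Balaban1985Averaging] ((8)–(12) p.19, (58) p.27, (82) p.30, (89) p.31, (125)–(127) p.36, Prop. 5 (157) p.42); CMP **102** (1985)
277–309 [Balaban1985Variational] ((44)–(46) p.285); CMP **109** (1987) 249–301 [Balaban1987RG1] ((0.3)–(0.6) pp.252–253).
-/

noncomputable section

open scoped BigOperators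
open NormedSpace Metric Set

namespace Summit.QuantumFields.YangMills.Theorems.Prop7DbarLinCovDefect

open Literature.MathematicalPhysics.QuantumFieldTheory.Balaban1983to89
open T4Continuum BlockAveraging AveragingRT ExpMeanLog
open B7Prop1Explicit (expUnit val_expUnit)
open MatrixLog (mlog mlog_one exp_mlog norm_mlog_le_two_mul)
open B10Eq27TorusAxialLog (holT gaugeActT gaugeActT_apply)
open Summit.QuantumFields.YangMills.Theorems.Prop8Chart (emlAvgU emlAvgU_gaugeActT emlAvgU_congr₂ holT_congr)
open Summit.QuantumFields.YangMills.Theorems.Prop8ChartDoubleBar (dbarAvgU)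
open Summit.QuantumFields.YangMills.Theorems.ChartHInv (blockOf_of_mem_walk_stairWord)
open Summit.QuantumFields.YangMills.Theorems.Prop7SymAvgTwSym (tstairU tstairU_def vframeCovU coe_vframeCovU dbarCovU dbarCovU_apply)
open Summit.QuantumFields.YangMills.Theorems.Prop7SymFrameCovariance (dbarCovU_gaugeActT)
open Summit.QuantumFields.YangMills.Theorems.Prop7SymFrameCovLocality (dbarCovU_congr₂)
open Summit.QuantumFields.YangMills.Theorems.Prop7DbarJointAnalytic (windows_of_budget norm_fderiv_dbarSlice_sub_fderiv_flat_le differentiableAt_dbarSlice_zero)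
open Summit.QuantumFields.YangMills.Theorems.Prop7SymAvgRelativeBound (expUnit_conj)
open Summit.QuantumFields.BalabanUV.T4Continuum (NE9RelativeChartPlaquette.norm_conj_le)

variable {P : Params} {j : ℕ}
variable {𝔸 : Type*} [NormedRing 𝔸] [NormedAlgebra ℂ 𝔸] [CompleteSpace 𝔸] [NormOneClass 𝔸]

/-! ## §1 Letters: conjugations, the gauged perturbed field, background locality, covariance of the relative double bar -/

omit [NormedAlgebra ℂ 𝔸] [CompleteSpace 𝔸] [NormOneClass 𝔸] in
/-- The bondwise conjugation `Ad_û Y (b) = û(b₋)Y(b)û(b₋)⁻¹` does not increase the sup norm (level `j`). [folklore] -/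
theorem norm_adField_le (û : GaugeTransf P j 𝔸ˣ) (hû : ∀ x, ‖((û x : 𝔸ˣ) : 𝔸)‖ ≤ 1) (hû' : ∀ x, ‖(((û x)⁻¹ : 𝔸ˣ) : 𝔸)‖ ≤ 1)
    (Y : PBond P j → 𝔸) : ‖(fun b : PBond P j => ((û b.src : 𝔸ˣ) : 𝔸) * Y b * (((û b.src)⁻¹ : 𝔸ˣ) : 𝔸))‖ ≤ ‖Y‖ := by
  refine (pi_norm_le_iff_of_nonneg (norm_nonneg Y)).2 fun b => ?_
  exact (NE9RelativeChartPlaquette.norm_conj_le (hû b.src) (hû' b.src)).trans (norm_le_pi_norm Y b)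

omit [NormOneClass 𝔸] in
/-- **THE GAUGED PERTURBED FIELD** (level `j`): `(e^{A}V₀)^{û}(b) = e^{Ad_û A(b)}·V₀^{û}(b)`. [cite: Balaban1985Averaging, (8) p.19] -/
theorem gaugeActT_perturbed (û : GaugeTransf P j 𝔸ˣ) (V₀ : GaugeField P j 𝔸ˣ) (A : PBond P j → 𝔸) (b : PBond P j) :
    gaugeActT û (fun b => expUnit (A b) * V₀ b) b =
      expUnit (((û b.src : 𝔸ˣ) : 𝔸) * A b * (((û b.src)⁻¹ : 𝔸ˣ) : 𝔸)) * gaugeActT û V₀ b := by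
  rw [gaugeActT_apply, gaugeActT_apply, ← expUnit_conj]
  group

omit [NormedAlgebra ℂ 𝔸] [CompleteSpace 𝔸] [NormOneClass 𝔸] in
/-- **THE TWISTED STAIR TRANSPORTER READS THE BACKGROUND ONLY INSIDE `B(y)`** (its `U₀`-leg is the same centre staircase). [cite: Balaban1985Averaging, (58) p.27; Balaban1987RG1, (0.3) p.252] -/
theorem tstairU_congr_bg (hj : j + 1 ≤ P.m + P.K) {U₀ U₀' : GaugeField P j 𝔸ˣ} (W : GaugeField P j 𝔸ˣ) (y : Site P (j + 1))
    (hUU' : ∀ b : PBond P j, blockOf b.src = y → blockOf b.tgt = y → U₀ b = U₀' b) (i : Idx P) :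
    tstairU U₀ W y i = tstairU U₀' W y i := by
  rw [tstairU_def, tstairU_def, holT_congr (U := U₀) (U' := U₀') (stairWord i.2.1 (off i.1)) (emb y) fun s hs =>
    hUU' s.bond (blockOf_of_mem_walk_stairWord hj y i.2.1 i.1 hs).1 (blockOf_of_mem_walk_stairWord hj y i.2.1 i.1 hs).2]

omit [NormOneClass 𝔸] in
/-- **THE COVARIANT FRAME READS THE BACKGROUND ONLY INSIDE `B(y)`.** [cite: Balaban1985Averaging, (82) p.30; Balaban1987RG1, (0.3) p.252] -/
theorem vframeCovU_congr_bg (hj : j + 1 ≤ P.m + P.K) {U₀ U₀' : GaugeField P j 𝔸ˣ} (W : GaugeField P j 𝔸ˣ) (y : Site P (j + 1))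
    (hUU' : ∀ b : PBond P j, blockOf b.src = y → blockOf b.tgt = y → U₀ b = U₀' b) : vframeCovU U₀ W y = vframeCovU U₀' W y := by
  apply Units.ext
  rw [coe_vframeCovU, coe_vframeCovU]
  have h : (fun i : Idx P => ((tstairU U₀ W y i : 𝔸ˣ) : 𝔸)) = fun i : Idx P => ((tstairU U₀' W y i : 𝔸ˣ) : 𝔸) := by
    funext i; rw [tstairU_congr_bg hj W y hUU' i]
  rw [h]

omit [NormOneClass 𝔸] in
/-- ★ **THE COVARIANT DOUBLE BAR READS THE BACKGROUND ONLY ON THE TWO-BLOCK BONDS OF `c`** (the frames at `c₋`, `c₊`; the single bar does not see `U₀`).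
[cite: Balaban1985Averaging, (89) p.31; Balaban1987RG1, (0.4) p.253] -/
theorem dbarCovU_congr_bg (hj : j + 1 ≤ P.m + P.K) {U₀ U₀' : GaugeField P j 𝔸ˣ} (W : GaugeField P j 𝔸ˣ) (c : PBond P (j + 1))
    (hUU' : ∀ b : PBond P j, (blockOf b.src = c.src ∨ blockOf b.src = c.tgt) → (blockOf b.tgt = c.src ∨ blockOf b.tgt = c.tgt) → U₀ b = U₀' b) :
    dbarCovU U₀ W c = dbarCovU U₀' W c := by
  rw [dbarCovU_apply, dbarCovU_apply, vframeCovU_congr_bg hj W c.src (fun b h1 h2 => hUU' b (Or.inl h1) (Or.inl h2)),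
    vframeCovU_congr_bg hj W c.tgt (fun b h1 h2 => hUU' b (Or.inr h1) (Or.inr h2))]

omit [NormOneClass 𝔸] in
/-- ★ **COVARIANCE OF THE RELATIVE DOUBLE BAR**: `U̿(V₀; W)(c)·Ū(V₀)(c)⁻¹ = T⁻¹·[U̿(V₀^{û}; W^{û})(c)·Ū(V₀^{û})(c)⁻¹]·T`, `T := û(emb c₋)` — the double bar and the single bar of
the background are both level-`(j+1)` fields under `û ∘ emb` (✓`dbarCovU_gaugeActT`, ✓`emlAvgU_gaugeActT`), so their ratio at `c` conjugates at the centre of `B(c₋)`.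
[cite: Balaban1985Averaging, (11)-(12) p.19, (89) p.31] -/
theorem dbarRel_eq_conj (û : GaugeTransf P j 𝔸ˣ) (V₀ W : GaugeField P j 𝔸ˣ) (c : PBond P (j + 1)) :
    ((dbarCovU V₀ W c : 𝔸ˣ) : 𝔸) * (((emlAvgU V₀ c)⁻¹ : 𝔸ˣ) : 𝔸) =
      (((û (emb c.src))⁻¹ : 𝔸ˣ) : 𝔸) *
        (((dbarCovU (gaugeActT û V₀) (gaugeActT û W) c : 𝔸ˣ) : 𝔸) * (((emlAvgU (gaugeActT û V₀) c)⁻¹ : 𝔸ˣ) : 𝔸)) *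
        ((û (emb c.src) : 𝔸ˣ) : 𝔸) := by
  have h : dbarCovU V₀ W c * (emlAvgU V₀ c)⁻¹ =
      (û (emb c.src))⁻¹ * (dbarCovU (gaugeActT û V₀) (gaugeActT û W) c * (emlAvgU (gaugeActT û V₀) c)⁻¹) * û (emb c.src) := by
    rw [dbarCovU_gaugeActT, emlAvgU_gaugeActT, gaugeActT_apply, gaugeActT_apply]
    group
  have h' := congrArg (fun u : 𝔸ˣ => (u : 𝔸)) h
  simpa only [Units.val_mul] using h'

/-! ## §2 ★★★ The covariant linearisation row of the double-bar one step -/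

/-- ★★★ **THE COVARIANT LINEARISATION ROW.**  Background `V₀`, a norm-`≤ 1` gauge `û` making `V₀` `s_B`-flat on the two blocks of `c` (`0 ≤ s_B`, `4s_B < ρ`), one-step budget
`10⁷ℓ²ρ ≤ 1`.  Then the one-step chart `A ↦ log[U̿(V₀; e^{A}V₀)(c)·Ū(V₀)(c)⁻¹]` is differentiable at `0`, and for every `Y`
`‖∂_A|₀ chart·Y − T⁻¹·(∂_A|₀ log U̿(e^{A})(c)·(Ad_û Y))·T‖ ≤ (16·(12Lρ)∕ρ²)·(2s_B)·‖Y‖`, `T := û(emb c₋)`.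
[cite: Balaban1985Averaging, (8)-(12) p.19, (89) p.31, (125)-(127) p.36, Prop. 5 (157) p.42; Balaban1985Variational, (44)-(46) p.285; Balaban1987RG1, (0.4) p.253] -/
theorem differentiableAt_dbarLogRel_zero (hj : j + 1 ≤ P.m + P.K) (c : PBond P (j + 1)) (V₀ : GaugeField P j 𝔸ˣ) (û : GaugeTransf P j 𝔸ˣ)
    (hû : ∀ x, ‖((û x : 𝔸ˣ) : 𝔸)‖ ≤ 1) (hû' : ∀ x, ‖(((û x)⁻¹ : 𝔸ˣ) : 𝔸)‖ ≤ 1) {sB ρ : ℝ} (hρ0 : 0 < ρ)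
    (hbudget : 10000000 * (((P.d + 2) * P.L : ℕ) : ℝ) ^ 2 * ρ ≤ 1) (hsB0 : 0 ≤ sB) (hsB : 4 * sB < ρ)
    (hV : ∀ b : PBond P j, (blockOf b.src = c.src ∨ blockOf b.src = c.tgt) → (blockOf b.tgt = c.src ∨ blockOf b.tgt = c.tgt) →
      ‖((gaugeActT û V₀ b : 𝔸ˣ) : 𝔸) - 1‖ ≤ sB) :
    DifferentiableAt ℂ (fun A : PBond P j → 𝔸 =>
      mlog (((dbarCovU V₀ (fun b => expUnit (A b) * V₀ b) c : 𝔸ˣ) : 𝔸) * (((emlAvgU V₀ c)⁻¹ : 𝔸ˣ) : 𝔸))) 0 ∧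
    ∀ Y : PBond P j → 𝔸,
      ‖fderiv ℂ (fun A : PBond P j → 𝔸 =>
            mlog (((dbarCovU V₀ (fun b => expUnit (A b) * V₀ b) c : 𝔸ˣ) : 𝔸) * (((emlAvgU V₀ c)⁻¹ : 𝔸ˣ) : 𝔸))) 0 Y -
          (((û (emb c.src))⁻¹ : 𝔸ˣ) : 𝔸) *
            fderiv ℂ (fun A : PBond P j → 𝔸 => mlog ((dbarAvgU (fun b => expUnit (A b)) c : 𝔸ˣ) : 𝔸)) 0
              (fun b : PBond P j => ((û b.src : 𝔸ˣ) : 𝔸) * Y b * (((û b.src)⁻¹ : 𝔸ˣ) : 𝔸)) *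
            ((û (emb c.src) : 𝔸ˣ) : 𝔸)‖ ≤
        16 * (12 * (P.L : ℝ) * ρ) / ρ ^ 2 * (2 * sB) * ‖Y‖ := by
  classical
  have hρ4 : ρ ≤ 1 / 4 := (windows_of_budget (P := P) hρ0.le hbudget).1
  -- letters
  set T : 𝔸ˣ := û (emb c.src) with hT
  have hTn : ‖(T : 𝔸)‖ ≤ 1 := hû (emb c.src)
  have hTn' : ‖((T⁻¹ : 𝔸ˣ) : 𝔸)‖ ≤ 1 := hû' (emb c.src)
  set flat : (PBond P j → 𝔸) → 𝔸 := fun X => mlog ((dbarAvgU (fun b => expUnit (X b)) c : 𝔸ˣ) : 𝔸) with hflat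
  set V : GaugeField P j 𝔸ˣ := gaugeActT û V₀ with hVdef
  set TB : PBond P j → Prop := fun b =>
    (blockOf b.src = c.src ∨ blockOf b.src = c.tgt) ∧ (blockOf b.tgt = c.src ∨ blockOf b.tgt = c.tgt) with hTB
  set B₀ : PBond P j → 𝔸 := fun b => if TB b then mlog ((V b : 𝔸ˣ) : 𝔸) else 0 with hB₀
  -- sizes: `‖B₀‖ ≤ 2 s_B < ρ/2`
  have hVb : ∀ b, TB b → ‖((V b : 𝔸ˣ) : 𝔸) - 1‖ ≤ sB := fun b hb => hV b hb.1 hb.2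
  have hB₀b : ∀ b, ‖B₀ b‖ ≤ 2 * sB := by
    intro b
    by_cases hb : TB b
    · have h1 : ‖((V b : 𝔸ˣ) : 𝔸) - 1‖ ≤ 1 / 2 := (hVb b hb).trans (by linarith)
      simp only [hB₀, hb, if_true]
      exact (norm_mlog_le_two_mul h1).trans (by linarith [hVb b hb])
    · simp only [hB₀, hb, if_false, norm_zero]; positivity
  have hB₀n : ‖B₀‖ ≤ 2 * sB := (pi_norm_le_iff_of_nonneg (by positivity)).2 hB₀b
  have hB₀lt : ‖B₀‖ < ρ / 2 := by linarith
  -- (2) on two-block bonds `V b = e^{B₀ b}`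
  have hagree : ∀ b, TB b → expUnit (B₀ b) = V b := by
    intro b hb
    apply Units.ext
    rw [val_expUnit]
    simp only [hB₀, hb, if_true]
    exact exp_mlog ((hVb b hb).trans_lt (by linarith))
  -- the conjugations as continuous linear maps
  set AdL : (PBond P j → 𝔸) →L[ℂ] (PBond P j → 𝔸) :=
    ContinuousLinearMap.pi fun b : PBond P j =>
      ((ContinuousLinearMap.mulLeftRight ℂ 𝔸) ((û b.src : 𝔸ˣ) : 𝔸) (((û b.src)⁻¹ : 𝔸ˣ) : 𝔸)).comp (ContinuousLinearMap.proj b) with hAdL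
  have hAdL_apply : ∀ Y : PBond P j → 𝔸, AdL Y = fun b => ((û b.src : 𝔸ˣ) : 𝔸) * Y b * (((û b.src)⁻¹ : 𝔸ˣ) : 𝔸) := by
    intro Y; funext b
    simp [hAdL, ContinuousLinearMap.mulLeftRight_apply]
  set conjL : 𝔸 →L[ℂ] 𝔸 := (ContinuousLinearMap.mulLeftRight ℂ 𝔸) ((T⁻¹ : 𝔸ˣ) : 𝔸) (T : 𝔸) with hconjL
  have hconjL_apply : ∀ Z, conjL Z = ((T⁻¹ : 𝔸ˣ) : 𝔸) * Z * (T : 𝔸) := fun Z => by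
    simp [hconjL, ContinuousLinearMap.mulLeftRight_apply]
  -- the slice of the joint double-bar chart at `B₀`
  set slice : (PBond P j → 𝔸) → 𝔸 := fun X =>
    mlog (((dbarCovU (fun b => expUnit (B₀ b)) (fun b => expUnit (X b) * expUnit (B₀ b)) c : 𝔸ˣ) : 𝔸) *
      (((emlAvgU (fun b => expUnit (B₀ b)) c)⁻¹ : 𝔸ˣ) : 𝔸)) with hslice
  -- (1)+(2)+(3): the chart at `V₀` is `conjL ∘ slice ∘ AdL`
  have hstep1 : ∀ A : PBond P j → 𝔸, dbarCovU V (gaugeActT û (fun b => expUnit (A b) * V₀ b)) c =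
      dbarCovU (fun b => expUnit (B₀ b)) (fun b => expUnit ((AdL A) b) * expUnit (B₀ b)) c := by
    intro A
    rw [dbarCovU_congr₂ hj V c (W' := fun b => expUnit ((AdL A) b) * expUnit (B₀ b)) fun b hbs hbt => by
      rw [gaugeActT_perturbed, ← hVdef, hagree b ⟨hbs, hbt⟩, hAdL_apply]]
    exact dbarCovU_congr_bg hj _ c fun b hbs hbt => (hagree b ⟨hbs, hbt⟩).symm
  have hstep2 : emlAvgU V c = emlAvgU (fun b => expUnit (B₀ b)) c := by
    refine emlAvgU_congr₂ hj c fun b hbs hbt => ?_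
    rw [hagree b ⟨hbs, hbt⟩]
  have hfunU : (fun A : PBond P j → 𝔸 =>
      mlog (((dbarCovU V₀ (fun b => expUnit (A b) * V₀ b) c : 𝔸ˣ) : 𝔸) * (((emlAvgU V₀ c)⁻¹ : 𝔸ˣ) : 𝔸))) = fun A => conjL (slice (AdL A)) := by
    funext A
    rw [hconjL_apply, dbarRel_eq_conj û V₀ (fun b => expUnit (A b) * V₀ b) c, ← hT, ← hVdef, hstep1 A, hstep2,
      ExpMeanLog.mlog_conj (Units.inv_mul T) (Units.mul_inv T)]
  -- differentiability: slice at `0 = AdL 0`, then the two compositions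
  have hslice_diff : DifferentiableAt ℂ slice 0 := differentiableAt_dbarSlice_zero hj c hρ0 hbudget B₀ (by linarith)
  have hAd0 : AdL 0 = 0 := map_zero AdL
  have hslice_at : HasFDerivAt slice (fderiv ℂ slice 0) (AdL 0) := by rw [hAd0]; exact hslice_diff.hasFDerivAt
  have hcomp1 : HasFDerivAt (fun A : PBond P j → 𝔸 => slice (AdL A)) ((fderiv ℂ slice 0).comp AdL) 0 :=
    HasFDerivAt.comp (f := fun A : PBond P j → 𝔸 => AdL A) (0 : PBond P j → 𝔸) hslice_at AdL.hasFDerivAt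
  have hcomp2 : HasFDerivAt (fun A : PBond P j → 𝔸 => conjL (slice (AdL A))) (conjL.comp ((fderiv ℂ slice 0).comp AdL)) 0 :=
    HasFDerivAt.comp (f := fun A : PBond P j → 𝔸 => slice (AdL A)) (0 : PBond P j → 𝔸) conjL.hasFDerivAt hcomp1
  rw [hfunU]
  refine ⟨hcomp2.differentiableAt, fun Y => ?_⟩
  rw [hcomp2.fderiv]
  -- (4): the Schwarz bound of FILE A, read on `Ad_û Y`
  have hkey := norm_fderiv_dbarSlice_sub_fderiv_flat_le hj c hρ0 hbudget B₀ hB₀lt (AdL Y)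
  have hAdY : (fun b : PBond P j => ((û b.src : 𝔸ˣ) : 𝔸) * Y b * (((û b.src)⁻¹ : 𝔸ˣ) : 𝔸)) = AdL Y := (hAdL_apply Y).symm
  have hAdYn : ‖AdL Y‖ ≤ ‖Y‖ := by rw [hAdL_apply]; exact norm_adField_le û hû hû' Y
  rw [hAdY, ContinuousLinearMap.comp_apply, ContinuousLinearMap.comp_apply, hconjL_apply]
  have hdiff_eq : ((T⁻¹ : 𝔸ˣ) : 𝔸) * (fderiv ℂ slice 0) (AdL Y) * (T : 𝔸) - ((T⁻¹ : 𝔸ˣ) : 𝔸) * fderiv ℂ flat 0 (AdL Y) * (T : 𝔸) =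
      ((T⁻¹ : 𝔸ˣ) : 𝔸) * ((fderiv ℂ slice 0) (AdL Y) - fderiv ℂ flat 0 (AdL Y)) * (T : 𝔸) := by noncomm_ring
  rw [hdiff_eq]
  have hC0 : 0 ≤ 16 * (12 * (P.L : ℝ) * ρ) / ρ ^ 2 := by positivity
  calc ‖((T⁻¹ : 𝔸ˣ) : 𝔸) * ((fderiv ℂ slice 0) (AdL Y) - fderiv ℂ flat 0 (AdL Y)) * (T : 𝔸)‖
      ≤ ‖(fderiv ℂ slice 0) (AdL Y) - fderiv ℂ flat 0 (AdL Y)‖ := NE9RelativeChartPlaquette.norm_conj_le hTn' hTn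
    _ ≤ 16 * (12 * (P.L : ℝ) * ρ) / ρ ^ 2 * ‖B₀‖ * ‖AdL Y‖ := hkey
    _ ≤ 16 * (12 * (P.L : ℝ) * ρ) / ρ ^ 2 * (2 * sB) * ‖Y‖ := by
        have h1 : 0 ≤ ‖AdL Y‖ := norm_nonneg _
        have h2 : 0 ≤ ‖B₀‖ := norm_nonneg _
        calc _ ≤ 16 * (12 * (P.L : ℝ) * ρ) / ρ ^ 2 * (2 * sB) * ‖AdL Y‖ := by gcongr
          _ ≤ _ := by gcongr

end Summit.QuantumFields.YangMills.Theorems.Prop7DbarLinCovDefect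

end
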